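import Summits.ValiantsHypothesis.ValiantsHypothesis.Theorems.KPlusLogSqLawStaticPathFoldDefs

/-!
# Route «KPlusLogSqLaw» — parametric maximum-weight independent set on a PATH: prefix optima and trains (definitions)

HONEST FRAMING.  Definitions file (D-0009: reviewed/audited) for `…Theorems.KPlusLogSqLaw.StaticPathFold` part 3
(`KPlusLogSqLawStaticPathTrain.lean`), a helper toward the crux `WeakLifting` (item `stmt-ValiantsHypothesis-19561`, route
`KPlusLogSqLaw`; cell `pub-symmetroid`, seat val-sym-lift-p3 g6, 2026-08-27) on the line of its witness-plan stub
`stub_tridiagonalSectorB`: the tropical twin of the STATIC tridiagonal sector is parametric maximum-weight independent set on a path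
(val-sym-lift-p4 g6, `HOME/val-sym-lift-p4/STATIC-PATH-NLOGN.md` §0–1).  Items `1, …, n` (consecutive items conflict) carry LINES
`W t θ = w₁ t * θ + w₀ t` (index `0` unused).  This file names: the DP prefix optima `F k` (`F 0 = 0`, `F 1 = max 0 (W 1)`,
`F (k+2) = max (F (k+1)) (F k + W (k+2))` — the optimum over independent subsets of `1..k`), the LEFT TRAIN `Δ k` (`Δ 0 = 0`,
`Δ (k+1) = max 0 (W (k+1) - Δ k)`), and the coefficients `altA`, `altB` of the signed prefix-sum lines `S t = Σ_{i ≤ t} (-1)^i W i`,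
so that `S t = StaticPathFold.L (altA w₁) (altB w₀) t` and the alternating fold of part 1 applies to them.  No `Prop` is asserted; nothing here
bears on `WeakLifting`, `TropicalB`, `KPlusLogSqLaw`, the stub in its window, `MatrixDescartes` (stmt-ValiantsHypothesis-18050) or `VP ≠ VNP`.

[folklore] (dynamic programming on a path; Gusfield-type trains).
-/

set_option linter.dupNamespace false
set_option autoImplicit false

namespace Summit.ValiantsHypothesis.ValiantsHypothesis.Theorems.KPlusLogSqLaw

namespace StaticPathFold

noncomputable section

variable (w₁ w₀ : ℕ → ℝ)

/-- the item lines `W t θ = w₁ t * θ + w₀ t` (items are `t ≥ 1`). [folklore] -/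
def W (t : ℕ) (θ : ℝ) : ℝ := w₁ t * θ + w₀ t

/-- prefix optima of maximum-weight independent set on the path `1, …, k` (empty set allowed):
`F 0 = 0`, `F 1 = max 0 (W 1)`, `F (k+2) = max (F (k+1)) (F k + W (k+2))`. [folklore] -/
def F : ℕ → ℝ → ℝ
  | 0, _ => 0
  | 1, θ => max 0 (W w₁ w₀ 1 θ)
  | k + 2, θ => max (F (k + 1) θ) (F k θ + W w₁ w₀ (k + 2) θ)

/-- the left train: `Δ 0 = 0`, `Δ (k+1) = max 0 (W (k+1) - Δ k)` (it equals `F (k+1) - F k`, part 3). [folklore] -/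
def Δ : ℕ → ℝ → ℝ
  | 0, _ => 0
  | k + 1, θ => max 0 (W w₁ w₀ (k + 1) θ - Δ k θ)

/-- slope coefficients of the signed prefix sums `S t = Σ_{i ≤ t} (-1)^i W i`: `altA 0 = 0`, `altA (t+1) = altA t + (-1)^(t+1) w₁ (t+1)`. [folklore] -/
def altA : ℕ → ℝ
  | 0 => 0
  | t + 1 => altA t + (-1) ^ (t + 1) * w₁ (t + 1)

/-- intercept coefficients of the signed prefix sums: `altB 0 = 0`, `altB (t+1) = altB t + (-1)^(t+1) w₀ (t+1)`. [folklore] -/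
def altB : ℕ → ℝ
  | 0 => 0
  | t + 1 => altB t + (-1) ^ (t + 1) * w₀ (t + 1)

/-- defining equation of `F` at `k + 2`. [folklore] -/
theorem F_add_two (k : ℕ) (θ : ℝ) :
    F w₁ w₀ (k + 2) θ = max (F w₁ w₀ (k + 1) θ) (F w₁ w₀ k θ + W w₁ w₀ (k + 2) θ) := rfl

/-- defining equation of `Δ` at `k + 1`. [folklore] -/
theorem Δ_succ (k : ℕ) (θ : ℝ) : Δ w₁ w₀ (k + 1) θ = max 0 (W w₁ w₀ (k + 1) θ - Δ w₁ w₀ k θ) := rfl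

end

end StaticPathFold

end Summit.ValiantsHypothesis.ValiantsHypothesis.Theorems.KPlusLogSqLaw
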